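import Summits.ResolutionOfSingularities.ResolutionOfSingularities.Theses.PAlteration
import Summits.ResolutionOfSingularities.ResolutionOfSingularities.Theorems.PAlterationPicoverAffineModel

/-!
# The degree-`p` residue of the crux `Picover` over an AFFINE base is the local model
# `PicoverLocalModel` (line `degree-p-tower`, gen 2 — part 2 of 2)

Route `ResolutionOfSingularities/pAlteration`, crux `Picover` (stmt-ResolutionOfSingularities-0554).
The crux is equivalent to its degree-`p` residue (`Picover.IffDegP.picover_iff_picoverDegP`):

> `W` regular integral separated of finite type over a field `k` of characteristic `p`,
> `L ⊇ K(W)` purely inseparable of degree `p` ⟹ `HasResolution (normalizationIn W L)`,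

and the residue implies the rank-5 item `PicoverLocalModel` (stmt-0557,
`Picover.LocalModelOfDegP.picoverLocalModel_of_picoverDegP`). This file proves the CONVERSE for
affine `W` and packages the equivalence:

**Theorem** (`hasResolution_normalizationIn_of_isAffine_of_picoverLocalModel`). Assume
`PicoverLocalModel`. Let `k` be a field of characteristic `p`, `W` an AFFINE integral scheme,
locally of finite type over `k` and regular, and `L ⊇ K(W)` purely inseparable of degree `p`.
Then `normalizationIn W L` has a resolution of singularities.

**Corollary** (`picoverLocalModel_iff_affineResidue`). `PicoverLocalModel` ⟺ the residue for
affine `W`. So for affine bases the rank-2 crux and the rank-5 local model coincide; the whole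
gap between them is the passage from affine to separated `W` (Zariski gluing of resolutions of
`p`-th-root covers), and nothing else.

**Proof of the theorem.** Put `R = Γ(W, ⊤)` (a regular finitely generated `k`-domain with
`Frac R = K(W)`). By part 1 (`AffineModel.exists_generator_pow_eq`), `L = K(W)(z)` with
`z^p = c ∈ R`; the reduced model `Q = (R[T]/(T^p - c))_red` is a domain finite over `R`
(`LocalModelOfDegP.isPrime_nilradical_adjoinRoot`) with an injective `ψ : Q → L`, `T ↦ z`
(`AffineModel.exists_lift_of_pow_eq`, `AffineModel.injective_lift`). `PicoverLocalModel` resolves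
`Spec Q`, and `AffineModel.hasResolution_normalizationIn_of_affineModel` transports the
resolution to `normalizationIn W L`. The converse (`hasResolution_Spec_of_pow_eq_affine`) is the
landed `LocalModelOfDegP.hasResolution_Spec_of_pow_eq` with the residue assumed on affine bases
only (it is only ever applied to `Spec R`).

Sources: M. Temkin, *Inseparable local uniformization*, J. Algebra 373 (2013), Rem. 1.3.5 (ii)
(the local model `A₀[t]/(t^p - a)`); Q. Liu, *Algebraic Geometry and Arithmetic Curves* (2002),
§4.1.2. The algebra is folklore. No new definitions.
-/

noncomputable section

set_option linter.dupNamespace false -- mandated namespace of this single-conjunct summit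

open CategoryTheory AlgebraicGeometry TopologicalSpace Polynomial
open Literature.AlgebraicGeometry.Resolution Literature.AlgebraicGeometry.Motives
open Summit.ResolutionOfSingularities.ResolutionOfSingularities.Theorems.Picover

namespace Summit.ResolutionOfSingularities.ResolutionOfSingularities.Theorems.Picover.AffineOfLocalModel

/-! ## The affine residue on `Spec R` gives the monogenic covers `Spec R[t]`, `t ^ p ∈ R` -/

/-- **Resolution of `Spec R[t]`, `t^p = a ∈ R`, from the AFFINE degree-`p` residue.** Verbatim
the landed `LocalModelOfDegP.hasResolution_Spec_of_pow_eq`, except that the residue is assumed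
only for affine `W` (it is only ever applied to `W = Spec R`): `K(Spec Q)` is generated over
`K(Spec R)` by `t`, hence purely inseparable of degree `1` or `p`; the normalization of `Spec R`
in it has a resolution by the base case resp. the affine residue, and the finite birational
comparison transfers it to `Spec Q`.
-- adapted from Theorems/PAlterationPicoverLocalModelOfDegP.lean (same summit)
[cite: Temkin2013, Rem. 1.3.5 (ii)] -/
theorem hasResolution_Spec_of_pow_eq_affine
    (hAff : ∀ (p : ℕ), p.Prime → ∀ (k : Type) [Field k] [CharP k p] (W : Scheme.{0})
      [IsIntegral W] [IsAffine W] (f : W ⟶ Spec (.of k)) (L : Type) [Field L]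
      [Algebra W.functionField L], LocallyOfFiniteType f → Scheme.IsRegular W →
        IsPurelyInseparable W.functionField L → Module.finrank W.functionField L = p →
          Scheme.HasResolution (normalizationIn W L))
    {p : ℕ} (hp : p.Prime) (k : Type) [Field k] [CharP k p] {R Q : CommRingCat.{0}} [IsDomain R]
    [IsDomain Q] [CharP R p] (f : Spec R ⟶ Spec (.of k)) [LocallyOfFiniteType f]
    (hreg : Scheme.IsRegular (Spec R)) (φ : R ⟶ Q) [IsFinite (Spec.map φ)]
    (hφ : Function.Injective φ.hom) {t : Q} {a : R} (ht : t ^ p = φ.hom a)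
    (hgen : ∀ q : Q, ∃ P : R[X], P.eval₂ φ.hom t = q) :
    Scheme.HasResolution (Spec Q) := by
  haveI : IsDominant (Spec.map φ) := RatFn.isDominant_SpecMap_of_injective φ hφ
  haveI : CharP (Spec R).functionField p :=
    charP_of_injective_algebraMap (IsFractionRing.injective R (Spec R).functionField) p
  -- `ψ : Q → K(Spec Q) = L`, an extension of `K(Spec R)` through `(Spec φ)^♯`
  obtain ⟨ψ, hψ⟩ : ∃ ψ : Q →+* FunctionFieldOver (Spec.map φ),
      ∀ q, ψ q = FunctionFieldOver.of (Spec.map φ) (algebraMap Q (Spec Q).functionField q) :=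
    ⟨(FunctionFieldOver.of (Spec.map φ)).toRingHom.comp (algebraMap Q (Spec Q).functionField),
      fun _ => rfl⟩
  have hcomp : ∀ r : R, algebraMap (Spec R).functionField (FunctionFieldOver (Spec.map φ))
      (algebraMap R (Spec R).functionField r) = ψ (φ.hom r) := by
    intro r
    rw [FunctionFieldOver.algebraMap_apply, RatFn.functionFieldMap_SpecMap, hψ]
  have hx : ψ t ^ p = algebraMap (Spec R).functionField (FunctionFieldOver (Spec.map φ))
      (algebraMap R (Spec R).functionField a) := by
    rw [hcomp, ← map_pow, ht]
  have hmem : ∀ q : Q, ψ q ∈ IntermediateField.adjoin (Spec R).functionField {ψ t} := by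
    intro q
    obtain ⟨P, rfl⟩ := hgen q
    have hc : ψ.comp φ.hom = (algebraMap (Spec R).functionField
        (FunctionFieldOver (Spec.map φ))).comp (algebraMap R (Spec R).functionField) :=
      RingHom.ext fun r => (hcomp r).symm
    rw [hom_eval₂, hc, ← eval₂_map, ← aeval_def]
    exact IntermediateField.algebra_adjoin_le_adjoin _ _ (aeval_mem_adjoin_singleton _ _)
  have hgen' : IntermediateField.adjoin (Spec R).functionField {ψ t} = ⊤ := by
    rw [eq_top_iff]
    rintro y -
    obtain ⟨u, v, -, rfl⟩ :=
      IsFractionRing.div_surjective (A := Q) (show (Spec Q).functionField from y)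
    change FunctionFieldOver.of (Spec.map φ)
      (algebraMap Q (Spec Q).functionField u / algebraMap Q (Spec Q).functionField v) ∈ _
    rw [map_div₀, ← hψ, ← hψ]
    exact div_mem (hmem u) (hmem v)
  obtain ⟨hpi, hrank⟩ := LocalModelOfDegP.isPurelyInseparable_and_finrank_of_pow_mem hp hx hgen'
  have hK := FunctionFieldNormalizationIn.stub_functionField_normalizationIn (Spec R)
    (FunctionFieldOver (Spec.map φ))
  have hN : Scheme.HasResolution (normalizationIn (Spec R) (FunctionFieldOver (Spec.map φ))) := by
    rcases hrank with h1 | hP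
    · exact BaseCase.stub_baseCase (Spec R) (FunctionFieldOver (Spec.map φ)) hK hreg h1
    · exact hAff p hp k (Spec R) f (FunctionFieldOver (Spec.map φ)) inferInstance hreg hpi hP
  exact OfNormalizationIn.stub_ofNormalizationIn k (Spec Q) (Spec R) f (Spec.map φ) hK hN

/-! ## The affine residue from the local model -/

/-- **The affine residue from the local model.** Assume `PicoverLocalModel` (stmt-0557). For a
field `k` of characteristic `p`, an AFFINE integral scheme `W` locally of finite type over `k` and
regular, and a purely inseparable extension `L ⊇ K(W)` of degree `p`, the normalization of `W`
in `L` has a resolution of singularities. (Converse, for affine `W`, of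
`LocalModelOfDegP.picoverLocalModel_of_picoverDegP`.) [cite: Temkin2013, Rem. 1.3.5 (ii)] -/
theorem hasResolution_normalizationIn_of_isAffine_of_picoverLocalModel
    (hLM : Summit.ResolutionOfSingularities.ResolutionOfSingularities.Theses.PAlteration.PicoverLocalModel)
    {p : ℕ} (hp : p.Prime) (k : Type) [Field k] [CharP k p] (W : Scheme.{0}) [IsIntegral W]
    [IsAffine W] (f : W ⟶ Spec (.of k)) [LocallyOfFiniteType f] (L : Type) [Field L]
    [Algebra W.functionField L] (hreg : Scheme.IsRegular W)
    [IsPurelyInseparable W.functionField L] (hdeg : Module.finrank W.functionField L = p) :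
    Scheme.HasResolution (normalizationIn W L) := by
  classical
  haveI : Fact p.Prime := ⟨hp⟩
  haveI : FiniteDimensional W.functionField L :=
    Module.finite_of_finrank_pos (by rw [hdeg]; exact hp.pos)
  -- the coordinate ring `R = Γ(W, ⊤)`
  haveI : Nonempty (⊤ : W.Opens) := ⟨⟨genericPoint W, trivial⟩⟩
  have hU : IsAffineOpen (⊤ : W.Opens) := isAffineOpen_top W
  haveI : IsFractionRing Γ(W, ⊤) W.functionField :=
    functionField_isFractionRing_of_isAffineOpen W ⊤ hU
  haveI : IsLocallyNoetherian W := LocallyOfFiniteType.isLocallyNoetherian f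
  haveI hregR : IsRegularRing Γ(W, ⊤) := hreg.isRegularRing_of_isAffineOpen hU
  -- `k`-algebra structure and finite type
  let φ : k →+* Γ(W, ⊤) :=
    (f.appLE ⊤ ⊤ le_top).hom.comp (Scheme.ΓSpecIso (.of k)).inv.hom
  have hφ : φ.FiniteType := by
    refine RingHom.FiniteType.comp ?_ (RingHom.FiniteType.of_surjective _
      (Scheme.ΓSpecIso (.of k)).symm.commRingCatIsoToRingEquiv.surjective)
    exact HasRingHomProperty.appLE @LocallyOfFiniteType f ‹_› ⟨⊤, isAffineOpen_top _⟩ ⟨⊤, hU⟩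
      le_top
  letI : Algebra k Γ(W, ⊤) := φ.toAlgebra
  have hft : Algebra.FiniteType k Γ(W, ⊤) := hφ
  haveI : CharP Γ(W, ⊤) p := charP_of_injective_ringHom φ.injective p
  haveI : CharP W.functionField p := TowerTransport.charP_functionField W f
  -- a generator `z` of `L/K(W)` with `z ^ p = c ∈ R`
  obtain ⟨z, c, hztop, hzc⟩ :=
    AffineModel.exists_generator_pow_eq (R := Γ(W, ⊤)) (K := W.functionField) (L := L) hp hdeg
  -- the model `Q = (R[T]/(T^p - c))_red` and `ψ : Q → L`
  haveI := LocalModelOfDegP.isPrime_nilradical_adjoinRoot c hp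
  haveI : IsDomain (AdjoinRoot ((X : Γ(W, ⊤)[X]) ^ p - C c) ⧸
      nilradical (AdjoinRoot ((X : Γ(W, ⊤)[X]) ^ p - C c))) := Ideal.Quotient.isDomain _
  let iRL : Γ(W, ⊤) →+* L := (algebraMap W.functionField L).comp (algebraMap Γ(W, ⊤) _)
  have hiRL : Function.Injective iRL :=
    (algebraMap W.functionField L).injective.comp (IsFractionRing.injective Γ(W, ⊤) _)
  obtain ⟨ψ, hψR, hψz⟩ := AffineModel.exists_lift_of_pow_eq c iRL (z := z) hzc
  have hψinj : Function.Injective ψ := AffineModel.injective_lift c hp iRL hiRL ψ hψR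
  -- `Spec Q → Spec R` is finite and injective on rings
  have hinjS : Function.Injective
      (algebraMap Γ(W, ⊤) (AdjoinRoot ((X : Γ(W, ⊤)[X]) ^ p - C c))) := by
    rw [AdjoinRoot.algebraMap_eq]
    exact AdjoinRoot.of.injective_of_degree_ne_zero
      (by rw [degree_X_pow_sub_C hp.pos]; exact_mod_cast hp.ne_zero)
  haveI : Module.Finite Γ(W, ⊤) (AdjoinRoot ((X : Γ(W, ⊤)[X]) ^ p - C c)) :=
    (AdjoinRoot.powerBasis' (monic_X_pow_sub_C c hp.ne_zero)).finite
  haveI : Module.Finite Γ(W, ⊤) (AdjoinRoot ((X : Γ(W, ⊤)[X]) ^ p - C c) ⧸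
      nilradical (AdjoinRoot ((X : Γ(W, ⊤)[X]) ^ p - C c))) :=
    Module.Finite.trans (AdjoinRoot ((X : Γ(W, ⊤)[X]) ^ p - C c)) _
  haveI : IsFinite (Spec.map (CommRingCat.ofHom (algebraMap Γ(W, ⊤)
      (AdjoinRoot ((X : Γ(W, ⊤)[X]) ^ p - C c) ⧸
        nilradical (AdjoinRoot ((X : Γ(W, ⊤)[X]) ^ p - C c)))))) := by
    rw [IsFinite.SpecMap_iff, CommRingCat.hom_ofHom]
    exact RingHom.finite_algebraMap.mpr inferInstance
  -- the resolution of `Spec Q` from the local model, transported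
  have hQ := hLM p hp k Γ(W, ⊤) hft hregR c
  have ht : IntermediateField.adjoin W.functionField
      {ψ (Ideal.Quotient.mk _ (AdjoinRoot.root ((X : Γ(W, ⊤)[X]) ^ p - C c)))} = ⊤ := by
    rw [hψz]; exact hztop
  refine AffineModel.hasResolution_normalizationIn_of_affineModel k W f L
    (CommRingCat.of (AdjoinRoot ((X : Γ(W, ⊤)[X]) ^ p - C c) ⧸
      nilradical (AdjoinRoot ((X : Γ(W, ⊤)[X]) ^ p - C c))))
    (CommRingCat.ofHom (algebraMap Γ(W, ⊤) (AdjoinRoot ((X : Γ(W, ⊤)[X]) ^ p - C c) ⧸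
      nilradical (AdjoinRoot ((X : Γ(W, ⊤)[X]) ^ p - C c)))))
    ψ _ (LocalModelOfDegP.algebraMap_quotient_nilradical_injective (R := Γ(W, ⊤)) hinjS)
    hψinj ?_ ht hQ
  rw [CommRingCat.hom_ofHom]
  exact hψR

/-- **The local model is EQUIVALENT to the affine residue.** `PicoverLocalModel` (stmt-0557)
holds iff the degree-`p` residue of the crux `Picover` holds for AFFINE bases: for every prime
`p`, field `k` of characteristic `p`, affine integral `W` locally of finite type over `k` and
regular, and `L ⊇ K(W)` purely inseparable of degree `p`, `normalizationIn W L` has a resolution.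
(`→`: `hasResolution_normalizationIn_of_isAffine_of_picoverLocalModel`; `←`:
`hasResolution_Spec_of_pow_eq_affine` on `Q = (R[T]/(T^p - a))_red`, exactly as in the landed
`LocalModelOfDegP.picoverLocalModel_of_picoverDegP`.) Hence the gap between the rank-5 item and
the rank-2 crux (⟺ the residue for separated quasi-compact `W`, `IffDegP.picover_iff_picoverDegP`)
is exactly the passage from affine to separated bases. [cite: Temkin2013, Rem. 1.3.5 (ii)] -/
theorem picoverLocalModel_iff_affineResidue :
    Summit.ResolutionOfSingularities.ResolutionOfSingularities.Theses.PAlteration.PicoverLocalModel ↔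
    (∀ (p : ℕ), p.Prime → ∀ (k : Type) [Field k] [CharP k p] (W : Scheme.{0}) [IsIntegral W]
      [IsAffine W] (f : W ⟶ Spec (.of k)) (L : Type) [Field L] [Algebra W.functionField L],
      LocallyOfFiniteType f → Scheme.IsRegular W → IsPurelyInseparable W.functionField L →
        Module.finrank W.functionField L = p → Scheme.HasResolution (normalizationIn W L)) := by
  constructor
  · intro hLM p hp k _ _ W _ _ f L _ _ hft hreg hpi hdeg
    haveI := hft
    haveI := hpi
    exact hasResolution_normalizationIn_of_isAffine_of_picoverLocalModel hLM hp k W f L hreg hdeg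
  · intro hAff p hp k _ _ R _ _ _ hft hreg a
    haveI : Fact p.Prime := ⟨hp⟩
    haveI : CharP R p := charP_of_injective_algebraMap (algebraMap k R).injective p
    haveI := hft
    haveI := hreg
    have hinjS : Function.Injective (algebraMap R (AdjoinRoot ((X : R[X]) ^ p - C a))) := by
      rw [AdjoinRoot.algebraMap_eq]
      exact AdjoinRoot.of.injective_of_degree_ne_zero
        (by rw [degree_X_pow_sub_C hp.pos]; exact_mod_cast hp.ne_zero)
    haveI : Module.Finite R (AdjoinRoot ((X : R[X]) ^ p - C a)) :=
      (AdjoinRoot.powerBasis' (monic_X_pow_sub_C a hp.ne_zero)).finite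
    haveI : Module.Finite R
        (AdjoinRoot ((X : R[X]) ^ p - C a) ⧸ nilradical (AdjoinRoot ((X : R[X]) ^ p - C a))) :=
      Module.Finite.trans (AdjoinRoot ((X : R[X]) ^ p - C a)) _
    haveI := LocalModelOfDegP.isPrime_nilradical_adjoinRoot a hp
    haveI : IsDomain
        (AdjoinRoot ((X : R[X]) ^ p - C a) ⧸ nilradical (AdjoinRoot ((X : R[X]) ^ p - C a))) :=
      Ideal.Quotient.isDomain _
    haveI : LocallyOfFiniteType (Spec.map (CommRingCat.ofHom (algebraMap k R))) := by
      rw [HasRingHomProperty.Spec_iff (P := @LocallyOfFiniteType), CommRingCat.hom_ofHom]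
      exact RingHom.finiteType_algebraMap.mpr hft
    haveI : IsFinite (Spec.map (CommRingCat.ofHom (algebraMap R
        (AdjoinRoot ((X : R[X]) ^ p - C a) ⧸ nilradical (AdjoinRoot ((X : R[X]) ^ p - C a)))))) := by
      rw [IsFinite.SpecMap_iff, CommRingCat.hom_ofHom]
      exact RingHom.finite_algebraMap.mpr inferInstance
    have hroot : AdjoinRoot.root ((X : R[X]) ^ p - C a) ^ p = AdjoinRoot.of _ a := by
      have h := AdjoinRoot.eval₂_root ((X : R[X]) ^ p - C a)
      rwa [eval₂_sub, eval₂_X_pow, eval₂_C, sub_eq_zero] at h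
    refine hasResolution_Spec_of_pow_eq_affine hAff hp k
      (Spec.map (CommRingCat.ofHom (algebraMap k R))) (Scheme.isRegular_Spec (.of R))
      (CommRingCat.ofHom (algebraMap R _))
      (LocalModelOfDegP.algebraMap_quotient_nilradical_injective hinjS)
      (t := Ideal.Quotient.mk _ (AdjoinRoot.root _)) (a := a) ?_ ?_
    · change Ideal.Quotient.mk _ (AdjoinRoot.root _) ^ p =
        Ideal.Quotient.mk _ (algebraMap R (AdjoinRoot ((X : R[X]) ^ p - C a)) a)
      rw [← map_pow, hroot, AdjoinRoot.algebraMap_eq]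
    · intro q
      obtain ⟨s, rfl⟩ := Ideal.Quotient.mk_surjective q
      obtain ⟨P, rfl⟩ := AdjoinRoot.mk_surjective s
      refine ⟨P, ?_⟩
      change P.eval₂ ((Ideal.Quotient.mk _).comp (algebraMap R (AdjoinRoot ((X : R[X]) ^ p - C a))))
        (Ideal.Quotient.mk _ (AdjoinRoot.root _)) = _
      rw [← hom_eval₂, ← aeval_def, AdjoinRoot.aeval_eq]

end Summit.ResolutionOfSingularities.ResolutionOfSingularities.Theorems.Picover.AffineOfLocalModel

end
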